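/-
Copyright (c) 2026 the pub-hodgecm-mathlib formalisation cell (harness21).  Prover seat hodgecm-mathlib-K2E1-p13 (g2), Track B ∕ K2-LIT, h413 = `stmt-HodgeConjecture-24833`,
line `K2_E1_TraceFormulaBeta`, ROADCARD «5Res ENDGAME BY FAMILIES» (dealer K2E1-plan (g7) (229)): (H2) FILE 2 — the Galois twist on `U(1,1)`: it FIXES the rational points with `c`-fixed
entries (so `w₀`), INVERTS the unipotent radical `N(𝔸_F)` (the trace-zero line), preserves its inversion-invariant Haar measures, and intertwines the standard intertwining integral.
-/
import Summits.HodgeConjecture.HodgeConjecture.Theorems.K2E1QuasiSplitGaloisTwistU2     -- ★ (H2) FILE 1 p860213 (this seat): `exists_galTwist`, `borelHeight_galTwist`, `flatSectionU_comp_galTwist`, `galTwist_unipotent_mem`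
import Literature.NumberTheory.Automorphic.UnitaryGroupLineUnipotentTwo                  -- ★ `eq_middleRootUnipotent_two`, `middleCoord_inv_two` (the chart `N(𝔸_F) ≅ 𝔸_E⁻` at `N = 2`)
import Literature.NumberTheory.Automorphic.U3LocalBruhatDecompositionProofs               -- ★ `weylLongU`, `coe_coe_weylLongU`
import Mathlib.MeasureTheory.Group.Integral
import HarnessLib

/-!
# `K2E1QuasiSplitGaloisTwistUnipotentTwo` — (H2) FILE 2: THE GALOIS TWIST ON `U(1,1)`: `c_G(w₀) = w₀`, `c_G(u) = u⁻¹` ON `N(𝔸_F)`, HAAR INVARIANCE, AND THE EQUIVARIANCE OF THE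
# INTERTWINING INTEGRAL `M(φ ∘ c_G)(g) = (Mφ)(c_G g)`

Track B ∕ K2-LIT, crux h413 = `stmt-HodgeConjecture-24833`, route of record `HCCMUnconditional`; cell `hodgecm-mathlib`, squad K2, ENGINE E1.  THEOREMS ONLY (no `def`, no `instance`,
no `notation`, no `sorry`; default heartbeats); lane `--supports stmt-HodgeConjecture-24833 --as helper` (count-neutral).  Hypothesis-first on the twist `(cG, hcG)` of ★ FILE 1
(`exists_galTwist`).

THE MATHEMATICS ([Rogawski1990, §1.9–§1.10]; [MoeglinWaldspurger1995, II.1.6–II.1.7]).  §1 (generic `N`): `c_G` fixes every rational point whose matrix has `c`-fixed entries — `c_G(γ_𝔸) = γ_𝔸`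
when `γ.map c = γ` (`(c⊗1) ∘ ι_E = ι_E ∘ c`, ★ `algebraMap_conj`); in particular **`c_G(w₀) = w₀`** for the long Weyl element (its matrix is `J_N`, integer entries, ★ `coe_coe_weylLongU` +
`StdForm.over_map`).  §2 (`N = 2`): `N(𝔸_F) = {n(x) : x ∈ 𝔸_E⁻}` is the trace-zero line (★ `eq_middleRootUnipotent_two`, coordinate `middleCoord`), and `(c ⊗ 1)(x) = −x` on `𝔸_E⁻`, so
**`c_G(u) = u⁻¹`** (★ `middleCoord_inv_two`); hence `c_G` preserves every INVERSION-INVARIANT measure on `N(𝔸_F)` and, by Mathlib `integral_inv_eq_self`, **the intertwining integral is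
`c_G`-equivariant**: `∫_{N(𝔸)} f_z^{φ∘c_G}(w₀ v g) dν(v) = ∫_{N(𝔸)} f_z^φ(w₀ v c_G(g)) dν(v)` — the (H2) input of the tube letter `htube` of ★ `K2E1ChiScatteringConjSymmetryCMTwo` (with (H1) ★ and
the reality (H3) of normalised self-dual sections).
HONEST LABEL: HC_CM is proved only modulo the 7 printed citations (2 remaining named inputs: hLiu418 = `stmt-HodgeConjecture-24832`, h413 = `stmt-HodgeConjecture-24833`) until rung 0
closes; this file asserts no named fact, closes no socket; count-neutral; letter-free.  Remaining (H2) letters: (K) `K_max`-stability of `c_G`, (S) `χ`-sections ↦ `(χ∘c)`-sections.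
[cite: Rogawski1990, §1.9–§1.10] [cite: MoeglinWaldspurger1995, II.1.6–II.1.7]

## References
* [Rogawski1990] J. D. Rogawski, *Automorphic Representations of Unitary Groups in Three Variables* (1990), §1.9–§1.10.
* [MoeglinWaldspurger1995] C. Mœglin, J.-L. Waldspurger, *Spectral decomposition and Eisenstein series* (1995), II.1.6–II.1.7.
-/

set_option autoImplicit false
set_option linter.dupNamespace false  -- the mandated namespace repeats the summit's segment (`HodgeConjecture.HodgeConjecture`)

noncomputable section

open NumberField IsDedekindDomain MeasureTheory
open scoped NNReal MatrixGroups
open Literature.NumberTheory.Automorphic Literature.NumberTheory.Automorphic.UnitaryGroup AdelicGroupData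
open Summit.HodgeConjecture.HodgeConjecture.Cruxes.H413.K2E1BorelEisensteinU
open Summit.HodgeConjecture.HodgeConjecture.Cruxes.H413.K2E1QuasiSplitGaloisTwistU2

namespace Summit.HodgeConjecture.HodgeConjecture.Cruxes.H413.K2E1QuasiSplitGaloisTwistUnipotentTwo

variable {F E : Type} [Field F] [NumberField F] [Field E] [NumberField E] [Algebra F E] {c : E ≃ₐ[F] E} {N : ℕ}

/-! ## §1 (generic `N`) `c_G` fixes the rational points with `c`-fixed entries; `c_G(w₀) = w₀` -/

/-- **`c_G(γ_𝔸) = γ_𝔸` for a rational `γ` whose matrix has `c`-fixed entries** (`(c ⊗ 1)(ι x) = ι (c x)`, ★ `algebraMap_conj`). [cite: Rogawski1990, §1.9] -/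
theorem galTwist_toAdelic_of_map_eq {cG : (quasiSplit F E c N).Adelic →* (quasiSplit F E c N).Adelic}
    (hcG : ∀ g, adelicVal F E c N _ (cG g) = Matrix.GeneralLinearGroup.map (conjAdele F E c) (adelicVal F E c N _ g))
    (γ : ↥(unitaryGroupOfForm (c : E →+* E) ((StdForm.antidiagonal N).over E)))
    (hγ : (((γ : GL (Fin N) E)) : Matrix (Fin N) (Fin N) E).map (c : E →+* E) = ((γ : GL (Fin N) E) : Matrix (Fin N) (Fin N) E)) :
    cG ((quasiSplit F E c N).toAdelic γ) = (quasiSplit F E c N).toAdelic γ := by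
  apply adelicVal_injective F E c N
  apply Units.ext
  rw [coe_adelicVal_galTwist hcG]
  change ((((γ : GL (Fin N) E)) : Matrix (Fin N) (Fin N) E).map (algebraMap E (AdeleRing (𝓞 E) E))).map (conjAdele F E c) =
    (((γ : GL (Fin N) E)) : Matrix (Fin N) (Fin N) E).map (algebraMap E (AdeleRing (𝓞 E) E))
  rw [Matrix.map_map]
  have hfun : (conjAdele F E c : AdeleRing (𝓞 E) E → AdeleRing (𝓞 E) E) ∘ (algebraMap E (AdeleRing (𝓞 E) E)) = (algebraMap E (AdeleRing (𝓞 E) E)) ∘ (c : E →+* E) :=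
    funext fun x => (algebraMap_conj F E c x).symm
  rw [hfun, ← Matrix.map_map, hγ]

/-- **`c_G(w₀) = w₀`** for the long Weyl element of `U(J_N)` (its matrix is `J_N`, integer entries). [cite: Rogawski1990, §1.10 p. 9] -/
theorem galTwist_toAdelic_weylLongU {cG : (quasiSplit F E c N).Adelic →* (quasiSplit F E c N).Adelic}
    (hcG : ∀ g, adelicVal F E c N _ (cG g) = Matrix.GeneralLinearGroup.map (conjAdele F E c) (adelicVal F E c N _ g)) :
    cG ((quasiSplit F E c N).toAdelic (weylLongU (c : E →+* E) (rfl : (StdForm.antidiagonal N).over E = (StdForm.antidiagonal N).over E))) =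
      (quasiSplit F E c N).toAdelic (weylLongU (c : E →+* E) (rfl : (StdForm.antidiagonal N).over E = (StdForm.antidiagonal N).over E)) :=
  galTwist_toAdelic_of_map_eq hcG _ (by rw [coe_coe_weylLongU, StdForm.over_map])

/-! ## §2 (`N = 2`) `c_G` inverts `N(𝔸_F)`; inversion-invariant measures; the equivariance of the intertwining integral -/

section Two

variable {c : E ≃ₐ[F] E}

/-- **ON `U(1,1)`, `c_G(u) = u⁻¹` FOR `u ∈ N(𝔸_F)`**: `N(𝔸_F)` is the trace-zero line `{n(x) : (c⊗1)x = −x}` (★ `eq_middleRootUnipotent_two`), the `(0,1)` entry of `c_G(u)` is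
`(c⊗1)(u₀₁) = −u₀₁ = (u⁻¹)₀₁` (★ `middleCoord_inv_two`), and an element of `N(𝔸_F)` is determined by that entry. [cite: Rogawski1990, §1.10] -/
theorem galTwist_unipotent_eq_inv_two (hc : c * c = 1) {cG : (quasiSplit F E c 2).Adelic →* (quasiSplit F E c 2).Adelic}
    (hcG : ∀ g, adelicVal F E c 2 _ (cG g) = Matrix.GeneralLinearGroup.map (conjAdele F E c) (adelicVal F E c 2 _ g)) (u : ↥(adelicUnipotent F E c 2)) :
    cG (u : (quasiSplit F E c 2).Adelic) = ((u⁻¹ : ↥(adelicUnipotent F E c 2)) : (quasiSplit F E c 2).Adelic) := by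
  have hij : (((0 : Fin 2) : Fin 2) : ℕ) + 1 = (((1 : Fin 2) : Fin 2) : ℕ) := rfl
  have hN : 2 = 2 * (((0 : Fin 2) : Fin 2) : ℕ) + 2 := rfl
  -- `c_G u` as an element of `N(𝔸_F)`
  obtain ⟨u', hu'⟩ : ∃ u' : ↥(adelicUnipotent F E c 2), (u' : (quasiSplit F E c 2).Adelic) = cG u := ⟨⟨cG u, galTwist_unipotent_mem hc hcG u⟩, rfl⟩
  -- its coordinate is minus the coordinate of `u`, i.e. the coordinate of `u⁻¹`
  have hcoord : middleCoord hij hN u' = middleCoord hij hN u⁻¹ := by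
    apply Subtype.ext
    rw [middleCoord_inv_two, coe_middleCoord, AddSubgroup.coe_neg, coe_middleCoord, unipotentEntry_def, unipotentEntry_def, hu', coe_adelicVal_galTwist hcG,
      Matrix.map_apply]
    exact (mem_traceZeroAdele_iff _).1 (middleCoord hij hN u).2
  have hu : u' = u⁻¹ := by
    rw [eq_middleRootUnipotent_two hij hN u', eq_middleRootUnipotent_two hij hN u⁻¹, hcoord]
  rw [← hu', hu]

/-- **`c_G` restricted to `N(𝔸_F)` IS inversion** (as maps on the subgroup type). [cite: Rogawski1990, §1.10] -/
theorem galTwist_restrict_unipotent_eq_inv_two (hc : c * c = 1) {cG : (quasiSplit F E c 2).Adelic →* (quasiSplit F E c 2).Adelic}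
    (hcG : ∀ g, adelicVal F E c 2 _ (cG g) = Matrix.GeneralLinearGroup.map (conjAdele F E c) (adelicVal F E c 2 _ g)) :
    (fun u : ↥(adelicUnipotent F E c 2) => (⟨cG u, galTwist_unipotent_mem hc hcG u⟩ : ↥(adelicUnipotent F E c 2))) = fun u => u⁻¹ :=
  funext fun u => Subtype.ext (galTwist_unipotent_eq_inv_two hc hcG u)

/-- **`c_G` PRESERVES EVERY INVERSION-INVARIANT MEASURE ON `N(𝔸_F)`** (in particular its Haar measures: `N(𝔸_F)` is abelian at `N = 2`, and the structural letters of the Eisenstein files carry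
`[ν.IsInvInvariant]`). [cite: MoeglinWaldspurger1995, II.1.6] -/
theorem map_galTwist_unipotent_two (hc : c * c = 1) {cG : (quasiSplit F E c 2).Adelic →* (quasiSplit F E c 2).Adelic}
    (hcG : ∀ g, adelicVal F E c 2 _ (cG g) = Matrix.GeneralLinearGroup.map (conjAdele F E c) (adelicVal F E c 2 _ g))
    [MeasurableSpace (quasiSplit F E c 2).Adelic] [BorelSpace (quasiSplit F E c 2).Adelic] (ν : Measure ↥(adelicUnipotent F E c 2)) [ν.IsInvInvariant] :
    Measure.map (fun u : ↥(adelicUnipotent F E c 2) => (⟨cG u, galTwist_unipotent_mem hc hcG u⟩ : ↥(adelicUnipotent F E c 2))) ν = ν := by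
  rw [galTwist_restrict_unipotent_eq_inv_two hc hcG]
  exact Measure.map_inv_eq_self ν

/-- **THE INTERTWINING INTEGRAL IS `c_G`-EQUIVARIANT** (`N = 2`): for every `φ`, `z`, `g` and every inversion-invariant measure `ν` on `N(𝔸_F)`,
`∫ f_z^{φ ∘ c_G}(w₀ · v · g) dν(v) = ∫ f_z^φ(w₀ · v · c_G(g)) dν(v)` — `f_z^{φ∘c_G} = f_z^φ ∘ c_G` (★ FILE 1), `c_G(w₀ v g) = w₀ · c_G(v) · c_G(g) = w₀ · v⁻¹ · c_G(g)` (§1, §2), and `v ↦ v⁻¹`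
preserves `ν` (Mathlib `integral_inv_eq_self`).  The (H2) input of the tube identity `c(conj z; χ) = conj c(z; χ)`. [cite: MoeglinWaldspurger1995, II.1.6–II.1.7] [cite: Rogawski1990, §1.10] -/
theorem integral_flatSectionU_comp_galTwist_two (hc : c * c = 1) {cG : (quasiSplit F E c 2).Adelic →* (quasiSplit F E c 2).Adelic}
    (hcG : ∀ g, adelicVal F E c 2 _ (cG g) = Matrix.GeneralLinearGroup.map (conjAdele F E c) (adelicVal F E c 2 _ g))
    [MeasurableSpace (quasiSplit F E c 2).Adelic] [BorelSpace (quasiSplit F E c 2).Adelic] (ν : Measure ↥(adelicUnipotent F E c 2)) [ν.IsInvInvariant]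
    (φ : (quasiSplit F E c 2).Adelic → ℂ) (z : ℂ) (g : (quasiSplit F E c 2).Adelic) :
    ∫ v : ↥(adelicUnipotent F E c 2), flatSectionU (fun x => φ (cG x)) z
        ((quasiSplit F E c 2).toAdelic (weylLongU (c : E →+* E) (rfl : (StdForm.antidiagonal 2).over E = (StdForm.antidiagonal 2).over E)) * ((v : (quasiSplit F E c 2).Adelic) * g)) ∂ν =
      ∫ v : ↥(adelicUnipotent F E c 2), flatSectionU φ z
        ((quasiSplit F E c 2).toAdelic (weylLongU (c : E →+* E) (rfl : (StdForm.antidiagonal 2).over E = (StdForm.antidiagonal 2).over E)) * ((v : (quasiSplit F E c 2).Adelic) * cG g)) ∂ν := by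
  have h1 : ∀ v : ↥(adelicUnipotent F E c 2), flatSectionU (fun x => φ (cG x)) z
      ((quasiSplit F E c 2).toAdelic (weylLongU (c : E →+* E) (rfl : (StdForm.antidiagonal 2).over E = (StdForm.antidiagonal 2).over E)) * ((v : (quasiSplit F E c 2).Adelic) * g)) =
      flatSectionU φ z ((quasiSplit F E c 2).toAdelic (weylLongU (c : E →+* E) (rfl : (StdForm.antidiagonal 2).over E = (StdForm.antidiagonal 2).over E)) *
        ((((v⁻¹ : ↥(adelicUnipotent F E c 2))) : (quasiSplit F E c 2).Adelic) * cG g)) := fun v => by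
    rw [flatSectionU_comp_galTwist hcG]
    dsimp only
    rw [map_mul, map_mul, galTwist_toAdelic_weylLongU hcG, galTwist_unipotent_eq_inv_two hc hcG]
  simp_rw [h1]
  exact integral_inv_eq_self (fun v : ↥(adelicUnipotent F E c 2) => flatSectionU φ z
    ((quasiSplit F E c 2).toAdelic (weylLongU (c : E →+* E) (rfl : (StdForm.antidiagonal 2).over E = (StdForm.antidiagonal 2).over E)) * ((v : (quasiSplit F E c 2).Adelic) * cG g))) ν

end Two

end Summit.HodgeConjecture.HodgeConjecture.Cruxes.H413.K2E1QuasiSplitGaloisTwistUnipotentTwo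

end
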